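import Mathlib.Algebra.Ring.GeomSum
import Mathlib.LinearAlgebra.Isomorphisms
import Mathlib.Algebra.Module.LinearMap.End
import Mathlib.Algebra.BigOperators.Fin
import Mathlib.LinearAlgebra.Projection
import Mathlib.LinearAlgebra.FreeModule.PID
import Mathlib.LinearAlgebra.Dimension.Constructions
import Mathlib.Tactic.Abel
import HarnessLib

/-!
# Class X9, twisted hypothesis (im): the cokernel of `x - 1` for an endomorphism of finite order

HONEST FRAMING (cell `b2b-bsdres`, X9 prover lineage): pure commutative algebra serving the kernel
proof of the obligation node
`Summit.BirchSwinnertonDyer.BirchSwinnertonDyer.Rank1Residual.X9TwistedHypothesisIm`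
(`Theorems/Rank1ResidualX9SmallImageKolyvagin`, cell `bsd-smallim`).  No class-level claim is made.

Let `T` be a module over a commutative ring `R`, `x ∈ End_R(T)` with `x^m = 1`, and `m` invertible
in `R`, `c m = 1`.  The **averaging operator** `e = c ∑_{i<m} x^i` is an idempotent commuting with
`x`, with `x e = e` (`mul_avg_eq`, `isIdempotentElem_avg`); `(x - 1) e = 0`, and
`(x - 1) · c ∑_{i<m} i x^i = 1 - e` (`sub_one_mul_weightedAvg`: the telescoping identity
`(x - 1) ∑ i x^i = m x^m - ∑ x^i`).  Hence `range (x - 1) = range (1 - e) = ker e`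
(`range_sub_one_eq_ker_avg`) and

**Theorem** (`quotient_range_sub_one_equiv_range_avg`): `T / (x - 1) T ≃ range e = e T`.

Also: if `x t - t` lies in an `x`-stable submodule `S` then so does `e t - t`
(`avg_apply_sub_mem`); and over a principal ideal domain, an idempotent `e ≠ 0, 1` of a free
module of rank `2` has `range e ≃ R` (`nonempty_range_equiv_of_isIdempotentElem`: `range e` and
`ker e` are complementary, free, non-zero, of total rank `2`).  In the application `R = ℤ_p`,
`T = T_pE`, `x = ζ ρ(σ)` with `ρ(σ)` of finite order prime to `p` and `ζ` a root of unity; `e ≠ 0`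
and `e ≠ 1` are read off modulo `p`.

References: standard (group algebra of a cyclic group of invertible order; e.g. Serre, *Linear
representations of finite groups*, §2.6, the projector `(1/g) ∑ ρ(s)`) [folklore].
-/

open Finset

-- the summit and its single problem are both named `BirchSwinnertonDyer` (registry layout D-0017)
set_option linter.dupNamespace false

namespace Summit.BirchSwinnertonDyer.BirchSwinnertonDyer.Rank1Residual.TwistedIm

variable {R : Type*} [CommRing R] {T : Type*} [AddCommGroup T] [Module R T]

/-- `x · ∑_{i<m} x^i = ∑_{i<m} x^i` when `x^m = 1` (the sum is `x`-invariant). [folklore] -/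
theorem mul_geom_sum_eq_of_pow_eq_one {A : Type*} [Ring A] {x : A} {m : ℕ} (hx : x ^ m = 1) :
    x * ∑ i ∈ range m, x ^ i = ∑ i ∈ range m, x ^ i := by
  have h := mul_geom_sum x m
  rw [hx, sub_self, sub_mul, one_mul, sub_eq_zero] at h
  exact h

/-- `x^j · ∑_{i<m} x^i = ∑_{i<m} x^i` when `x^m = 1`. [folklore] -/
theorem pow_mul_geom_sum_eq_of_pow_eq_one {A : Type*} [Ring A] {x : A} {m : ℕ} (hx : x ^ m = 1)
    (j : ℕ) : x ^ j * ∑ i ∈ range m, x ^ i = ∑ i ∈ range m, x ^ i := by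
  induction j with
  | zero => rw [pow_zero, one_mul]
  | succ j ih => rw [pow_succ, mul_assoc, mul_geom_sum_eq_of_pow_eq_one hx, ih]

/-- **The telescoping identity** `(x - 1) · ∑_{i<m} i x^i = m - ∑_{i<m} x^i` when `x^m = 1`.
[folklore] -/
theorem sub_one_mul_sum_natCast_mul_pow {A : Type*} [Ring A] {x : A} {m : ℕ} (hx : x ^ m = 1) :
    (x - 1) * ∑ i ∈ range m, (i : A) * x ^ i = (m : A) - ∑ i ∈ range m, x ^ i := by
  have htel : ∑ i ∈ range m, (((i + 1 : ℕ) : A) * x ^ (i + 1) - (i : A) * x ^ i) =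
      (m : A) * x ^ m - ((0 : ℕ) : A) * x ^ 0 :=
    sum_range_sub (fun i => (i : A) * x ^ i) m
  rw [hx, mul_one, Nat.cast_zero, zero_mul, sub_zero] at htel
  have hshift : ∑ i ∈ range m, x ^ (i + 1) = ∑ i ∈ range m, x ^ i := by
    have := mul_geom_sum_eq_of_pow_eq_one hx
    rw [mul_sum] at this
    simpa only [pow_succ'] using this
  calc (x - 1) * ∑ i ∈ range m, (i : A) * x ^ i
      = ∑ i ∈ range m, ((i : A) * x ^ (i + 1) - (i : A) * x ^ i) := by
        rw [mul_sum]
        refine sum_congr rfl fun i _ => ?_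
        rw [sub_mul, one_mul, pow_succ', ← mul_assoc, ← mul_assoc, (Nat.cast_commute i x).eq]
    _ = ∑ i ∈ range m, ((((i + 1 : ℕ) : A) * x ^ (i + 1) - (i : A) * x ^ i) - x ^ (i + 1)) := by
        refine sum_congr rfl fun i _ => ?_
        rw [Nat.cast_succ, add_mul, one_mul]; abel
    _ = (m : A) - ∑ i ∈ range m, x ^ i := by rw [sum_sub_distrib, htel, hshift]

section Avg

variable (x : Module.End R T) {m : ℕ} {c : R}

/-- `x · e = e` for the averaging operator `e = c ∑_{i<m} x^i`, `x^m = 1`. [folklore] -/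
theorem mul_avg_eq (hx : x ^ m = 1) :
    x * (c • ∑ i ∈ range m, x ^ i) = c • ∑ i ∈ range m, x ^ i := by
  rw [mul_smul_comm, mul_geom_sum_eq_of_pow_eq_one hx]

/-- `e · x = e` for the averaging operator. [folklore] -/
theorem avg_mul_eq (hx : x ^ m = 1) :
    (c • ∑ i ∈ range m, x ^ i) * x = c • ∑ i ∈ range m, x ^ i := by
  have h := geom_sum_mul x m
  rw [hx, sub_self, mul_sub, mul_one, sub_eq_zero] at h
  rw [smul_mul_assoc, h]

/-- **The averaging operator is idempotent** (`c m = 1`): `e² = c ∑ x^i e = c m e = e`.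
[folklore] -/
theorem isIdempotentElem_avg (hx : x ^ m = 1) (hc : c * m = 1) :
    IsIdempotentElem (c • ∑ i ∈ range m, x ^ i) := by
  change (c • ∑ i ∈ range m, x ^ i) * (c • ∑ i ∈ range m, x ^ i) = c • ∑ i ∈ range m, x ^ i
  have hpow : ∀ j ∈ range m, x ^ j * (c • ∑ i ∈ range m, x ^ i) = c • ∑ i ∈ range m, x ^ i :=
    fun j _ => by rw [mul_smul_comm, pow_mul_geom_sum_eq_of_pow_eq_one hx]
  rw [smul_mul_assoc, sum_mul, sum_congr rfl hpow, sum_const, card_range,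
    ← Nat.cast_smul_eq_nsmul R, smul_smul, hc, one_smul]

/-- `(x - 1) · e = 0`. [folklore] -/
theorem sub_one_mul_avg (hx : x ^ m = 1) :
    (x - 1) * (c • ∑ i ∈ range m, x ^ i) = 0 := by
  rw [sub_mul, one_mul, mul_avg_eq x hx, sub_self]

/-- `e · (x - 1) = 0`. [folklore] -/
theorem avg_mul_sub_one (hx : x ^ m = 1) :
    (c • ∑ i ∈ range m, x ^ i) * (x - 1) = 0 := by
  rw [mul_sub, mul_one, avg_mul_eq x hx, sub_self]

/-- **`(x - 1) · c ∑ i x^i = 1 - e`** (`c m = 1`). [folklore] -/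
theorem sub_one_mul_weightedAvg (hx : x ^ m = 1) (hc : c * m = 1) :
    (x - 1) * (c • ∑ i ∈ range m, (i : Module.End R T) * x ^ i) =
      1 - c • ∑ i ∈ range m, x ^ i := by
  rw [mul_smul_comm, sub_one_mul_sum_natCast_mul_pow hx, smul_sub]
  congr 1
  rw [← Nat.smul_one_eq_cast, ← Nat.cast_smul_eq_nsmul R, smul_smul, hc, one_smul]

/-- **`range (x - 1) = range (1 - e)`.** [folklore] -/
theorem range_sub_one_eq_range_one_sub_avg (hx : x ^ m = 1) (hc : c * m = 1) :
    LinearMap.range (x - 1) = LinearMap.range (1 - c • ∑ i ∈ range m, x ^ i) := by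
  apply le_antisymm
  · -- `x - 1 = (1 - e)(x - 1)`
    have h : (1 - c • ∑ i ∈ range m, x ^ i) * (x - 1) = x - 1 := by
      rw [sub_mul, one_mul, avg_mul_sub_one x hx, sub_zero]
    rw [← h, Module.End.mul_eq_comp]
    exact LinearMap.range_comp_le_range _ _
  · rw [← sub_one_mul_weightedAvg x hx hc, Module.End.mul_eq_comp]
    exact LinearMap.range_comp_le_range _ _

/-- For an idempotent `e`, `range (1 - e) = ker e`. [folklore] -/
theorem range_one_sub_eq_ker_of_isIdempotentElem {e : Module.End R T} (he : IsIdempotentElem e) :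
    LinearMap.range (1 - e) = LinearMap.ker e := by
  apply le_antisymm
  · rintro _ ⟨t, rfl⟩
    rw [LinearMap.mem_ker, ← Module.End.mul_apply, mul_sub, mul_one, he.eq, sub_self,
      LinearMap.zero_apply]
  · intro t ht
    refine ⟨t, ?_⟩
    rw [LinearMap.sub_apply, Module.End.one_apply, LinearMap.mem_ker.mp ht, sub_zero]

/-- **`range (x - 1) = ker e`.** [folklore] -/
theorem range_sub_one_eq_ker_avg (hx : x ^ m = 1) (hc : c * m = 1) :
    LinearMap.range (x - 1) = LinearMap.ker (c • ∑ i ∈ range m, x ^ i) := by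
  rw [range_sub_one_eq_range_one_sub_avg x hx hc,
    range_one_sub_eq_ker_of_isIdempotentElem (isIdempotentElem_avg x hx hc)]

/-- **Theorem.** `T / (x - 1)T ≃ e T` for `x^m = 1`, `c m = 1`, `e = c ∑_{i<m} x^i`.
[folklore] -/
theorem quotient_range_sub_one_equiv_range_avg (hx : x ^ m = 1) (hc : c * m = 1) :
    Nonempty ((T ⧸ LinearMap.range (x - 1)) ≃ₗ[R]
      LinearMap.range (c • ∑ i ∈ range m, x ^ i)) :=
  ⟨(Submodule.quotEquivOfEq _ _ (range_sub_one_eq_ker_avg x hx hc)).trans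
    (LinearMap.quotKerEquivRange _)⟩

/-- If `x t - t` lies in an `x`-stable submodule `S`, then so does `x^j t - t`. [folklore] -/
theorem pow_apply_sub_mem {S : Submodule R T} (hS : ∀ y ∈ S, x y ∈ S) {t : T}
    (ht : x t - t ∈ S) (j : ℕ) : (x ^ j) t - t ∈ S := by
  induction j with
  | zero => rw [pow_zero, Module.End.one_apply, sub_self]; exact S.zero_mem
  | succ j ih =>
    have h : (x ^ (j + 1)) t - t = x ((x ^ j) t - t) + (x t - t) := by
      rw [pow_succ', Module.End.mul_apply, map_sub]; abel
    rw [h]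
    exact S.add_mem (hS _ ih) ht

/-- **If `x t ≡ t` modulo an `x`-stable submodule `S`, then `e t ≡ t (mod S)`** (`c m = 1`):
`e t - t = c ∑ (x^i t - t)`. [folklore] -/
theorem avg_apply_sub_mem (hc : c * m = 1) {S : Submodule R T} (hS : ∀ y ∈ S, x y ∈ S) {t : T}
    (ht : x t - t ∈ S) : (c • ∑ i ∈ range m, x ^ i) t - t ∈ S := by
  have h : (c • ∑ i ∈ range m, x ^ i) t - t = c • ∑ i ∈ range m, ((x ^ i) t - t) := by
    rw [LinearMap.smul_apply, LinearMap.coe_sum, Finset.sum_apply, sum_sub_distrib, sum_const,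
      card_range, smul_sub, ← Nat.cast_smul_eq_nsmul R, smul_smul, hc, one_smul]
  rw [h]
  exact S.smul_mem c (S.sum_mem fun i _ => pow_apply_sub_mem x hS ht i)

end Avg

/-! ### Rank one -/

section RankOne

variable {D : Type*} [CommRing D] [IsDomain D] [IsPrincipalIdealRing D]
  {M : Type*} [AddCommGroup M] [Module D M] [Module.Free D M] [Module.Finite D M]

/-- **Over a PID, an idempotent `e ≠ 0, 1` of a free module of rank `2` has image `≃ D`:**
`range e ⊕ ker e = M` with both summands free (finitely generated, torsion-free) and non-zero
(`ker e = range (1 - e)`), so both have rank `1`. [folklore] -/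
theorem nonempty_range_equiv_of_isIdempotentElem (hM : Module.finrank D M = 2)
    {e : Module.End D M} (he : IsIdempotentElem e) (h0 : e ≠ 0) (h1 : e ≠ 1) :
    Nonempty (LinearMap.range e ≃ₗ[D] D) := by
  have hc : IsCompl (LinearMap.range e) (LinearMap.ker e) := LinearMap.IsIdempotentElem.isCompl he
  haveI : Module.IsTorsionFree D M := inferInstance
  have hsum : Module.finrank D (LinearMap.range e) + Module.finrank D (LinearMap.ker e) = 2 := by
    rw [← Module.finrank_prod, (Submodule.prodEquivOfIsCompl _ _ hc).finrank_eq, hM]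
  have hr : Nontrivial (LinearMap.range e) :=
    (Submodule.nontrivial_iff_ne_bot).mpr (fun h => h0 (LinearMap.range_eq_bot.mp h))
  have hk : Nontrivial (LinearMap.ker e) := by
    refine (Submodule.nontrivial_iff_ne_bot).mpr fun h => h1 ?_
    rw [LinearMap.IsIdempotentElem.ker_eq_range_one_sub he, LinearMap.range_eq_bot, sub_eq_zero] at h
    exact h.symm
  have hr' : 0 < Module.finrank D (LinearMap.range e) :=
    (Module.finrank_pos_iff_of_free D _).mpr hr
  have hk' : 0 < Module.finrank D (LinearMap.ker e) :=
    (Module.finrank_pos_iff_of_free D _).mpr hk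
  have h1' : Module.finrank D (LinearMap.range e) = 1 := by omega
  exact ⟨(Module.nonempty_linearEquiv_of_finrank_eq_one h1').some.symm⟩

end RankOne

end Summit.BirchSwinnertonDyer.BirchSwinnertonDyer.Rank1Residual.TwistedIm
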